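import Literature.NumberTheory.Sieve.ChenShiftSeq
import HarnessLib

/-!
# Chen's Theorem II: the lower bound for `S(𝒜_h(x), x^{1/10})` (hypothesis (A) of the assembly)

Companion of `ChenShiftedAssembly.lean`, which assembles Chen's Theorem II
(`x_h(1,2) ≥ 0.67 x C_h/(log x)²`, Chen Jing-run, Sci. Sinica 16 (1973), Thm II) from three sieve
estimates for the shifted sequence `𝒜_h(x) = {p + h : p ≤ x}` at Chen's sieving level `x^{1/10}`.
This file PROVES hypothesis (A) of `Literature.NumberTheory.Sieve.Chen.Chen1973_theoremII_of`, with the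
constant `f₁(5) = lowerSieveFun 1 5`:

* `roughCount_shift_tenth_lower` — for even `h ≠ 0`, every `ε > 0` and all large `x`,
  `S(𝒜_h(x), ⌈x^{1/10}⌉) ≥ (f₁(5) − ε) · x V_h(x^{1/10})/log x`, `V_h = sieveProduct h`.

This is Chen's (31) for the sequence `{p + h}` ("by the same method", p. 176 of the original), and
the proof is a transcription of `Literature.NumberTheory.Sieve.Chen.siftedCount_tenth_lower`
(`ChenTheoremISiftedLower.lean`, the Goldbach sequence `{x − p}`) along the dictionary of
`ChenShiftSeq.lean`: Iwaniec's linear sieve, uniform in the sequence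
(`Iwaniec1980_thm1_lower_of_half_lt`, `κ = 1`, lower function `lowerSieveFun 1`, continuity at
`s = 5` absorbing the loss `δ` in the level `D = x^{1/2−δ}`), the Bombieri–Vinogradov theorem in
`π`-form with the residues `−h (mod d)` (`eventually_sum_abs_primeCountingDisc_le`,
`BombieriVinogradovStatement_holds`), the prime number theorem (`eventually_primeCounting_bounds`),
the dimension condition `hasIwaniecDimension_chenShiftSeq`, and the remainder estimate
`remainderSum_chenShiftSeq_le` (`R ≤ C x/(log x)⁴ + x^{1/2−δ}(h + 1) = o(x V_h/log x)`). The sifted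
subsequence `{p + h : h < p ≤ x}` gives the lower bound for the full `𝒜_h(x)` by monotonicity
(`roughCount_shiftSieveSet'_le`). No named facts.

## References

* Chen Jing-run, Sci. Sinica 16 (1973) 157–176, Lemma 9, (29)–(31), and §III (reprint: Wang Yuan
  (ed.), *Goldbach Conjecture*, 1984, PDF pp. 167–168). [ChenSciSinica1973]
* H. Iwaniec, *Rosser's sieve*, Acta Arith. 36 (1980), 171–202, Theorem 1. [IwaniecActaArith1980]
-/

open Finset Filter Topology

noncomputable section

namespace Literature.NumberTheory.Sieve.Chen

open SieveSequence ChenSieve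

set_option maxHeartbeats 800000 in
/-- **Chen's (31) for the shifted sequence (hypothesis (A) of `Chen1973_theoremII_of`), PROVED**:
for even `h ≠ 0`, every `ε > 0` and all large `x`,
`S(𝒜_h(x), ⌈x^{1/10}⌉) ≥ (f₁(5) − ε) x V_h(x^{1/10})/log x` with `f₁ = lowerSieveFun 1`,
`V_h = sieveProduct h`. Proof: the linear sieve lower bound (Iwaniec's Theorem 1 at `κ = 1`, uniform
in the sequence) for `chenShiftSeq h x` at level `D = x^{1/2−δ}` and `z = x^{1/10}` (`s = 5 − 10δ`,
`|f₁(s) − f₁(5)| ≤ ε/4` by continuity), remainders by Bombieri–Vinogradov in `π`-form with residues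
`−h (mod d)`, `X = π(x) = (1 + O(η)) x/log x`. [cite: ChenSciSinica1973, Lemma 9 eq. (31) and §III (reprint pp. 167–168)] -/
theorem roughCount_shift_tenth_lower {h : ℕ} (hh : Even h) (hh0 : h ≠ 0) {ε : ℝ} (hε : 0 < ε) :
    ∀ᶠ x : ℕ in atTop,
      (lowerSieveFun 1 5 - ε) *
          ((x : ℝ) * sieveProduct h ((x : ℝ) ^ (1 / 10 : ℝ)) / Real.log x) ≤
        roughCount (shiftSieveSet h x) (chenZ x) := by
  set a := lowerSieveFun 1 5 with ha
  -- the working accuracy `ε' = min ε 1`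
  set ε' := min ε 1 with hε'
  have hε'0 : 0 < ε' := lt_min hε one_pos
  have hε'ε : ε' ≤ ε := min_le_left _ _
  have hε'1 : ε' ≤ 1 := min_le_right _ _
  -- continuity of `f = lowerSieveFun 1` at `5`
  have hcont : ContinuousAt (lowerSieveFun 1) 5 :=
    (isBetaSieveSolution_upperSieveFun_one.continuousOn_lower).continuousAt
      (Ioi_mem_nhds (by norm_num : (0 : ℝ) < 5))
  obtain ⟨ρ, hρ0, hρ⟩ := Metric.continuousAt_iff.mp hcont (ε' / 4) (by positivity)
  -- parameters: level `x^{1/2 − δ}`, `s = 5 − 10δ`, PNT accuracy `η`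
  set δ := min (1 / 20) (ρ / 20) with hδ
  have hδ0 : 0 < δ := by positivity
  have hδ1 : δ ≤ 1 / 20 := min_le_left _ _
  have hδρ : δ ≤ ρ / 20 := min_le_right _ _
  set θ₁ := 1 / 2 - δ with hθ₁
  have hθ₁lt : θ₁ < 1 / 2 := by rw [hθ₁]; linarith
  have hθ₁pos : 0 < θ₁ := by rw [hθ₁]; linarith
  have hfs : |lowerSieveFun 1 (5 - 10 * δ) - a| < ε' / 4 := by
    have hd : dist (5 - 10 * δ) (5 : ℝ) < ρ := by
      rw [Real.dist_eq, show (5 : ℝ) - 10 * δ - 5 = -(10 * δ) by ring, abs_neg,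
        abs_of_pos (by positivity)]
      linarith
    have h1 := hρ hd
    rwa [Real.dist_eq] at h1
  set η := ε' / (16 * (|a| + 1)) with hη
  have hη0 : 0 < η := by positivity
  -- the linear sieve (Iwaniec's Theorem 1, `κ = 1`) and its constant for `Ω(1, L₀)`
  obtain ⟨B, hB, hBC⟩ := Iwaniec1980_thm1_lower_of_half_lt (κ := 1) (by norm_num)
  obtain ⟨C, hC⟩ := hBC dimConst
  have hfeq : Set.EqOn B.2.1 (iwaniecLowerSieveFun 1) (Set.Ioi 0) := hB.eqOn_iwaniecSieveFun.2.1
  -- Bombieri–Vinogradov (`π`-form, level `x^{θ₁}`)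
  obtain ⟨C₁, hC₁⟩ := eventually_sum_abs_primeCountingDisc_le BombieriVinogradovStatement_holds
    hθ₁lt (A := 4) (by norm_num)
  -- the constant of `V(z)⁻¹ ≤ κ₀ log x`
  have hlog2 : 0 < Real.log 2 := Real.log_pos one_lt_two
  have hdim0 : 0 ≤ dimConst := by rw [dimConst]; positivity
  set κ₀ := (1 + dimConst / Real.log 2) / (10 * Real.log 2) with hκ₀
  have hκ₀0 : 0 < κ₀ := by positivity
  have hh1 : (0 : ℝ) < (h : ℝ) + 1 := by positivity
  -- eventualities
  have hE1 := eventually_primeCounting_bounds hη0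
  have hE2 : ∀ᶠ N : ℕ in atTop, |C| * (θ₁ * Real.log N) ^ (-(1 / 3 : ℝ)) ≤ ε' / 16 := by
    have ht : Tendsto (fun x : ℝ => |C| * (θ₁ * Real.log x) ^ (-(1 / 3 : ℝ))) atTop
        (𝓝 (|C| * 0)) :=
      ((tendsto_rpow_neg_atTop (by norm_num : (0 : ℝ) < 1 / 3)).comp
        (Real.tendsto_log_atTop.const_mul_atTop hθ₁pos)).const_mul _
    rw [mul_zero] at ht
    exact tendsto_natCast_atTop_atTop.eventually (ht.eventually_le_const (by positivity))
  have hE3 : ∀ᶠ N : ℕ in atTop, 16 * κ₀ * max C₁ 0 ≤ ε' * Real.log N ^ 2 := by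
    have ht : Tendsto (fun x : ℝ => ε' * Real.log x ^ 2) atTop atTop :=
      ((tendsto_pow_atTop two_ne_zero).comp Real.tendsto_log_atTop).const_mul_atTop hε'0
    exact tendsto_natCast_atTop_atTop.eventually (ht.eventually_ge_atTop _)
  have hE4 : ∀ᶠ N : ℕ in atTop,
      Real.log (N : ℝ) ^ 2 ≤ ε' / (16 * κ₀ * ((h : ℝ) + 1)) * (N : ℝ) ^ (1 - θ₁) := by
    have hlo := (isLittleO_log_rpow_rpow_atTop 2 (show (0 : ℝ) < 1 - θ₁ by linarith)).def
      (show 0 < ε' / (16 * κ₀ * ((h : ℝ) + 1)) by positivity)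
    filter_upwards [tendsto_natCast_atTop_atTop.eventually hlo, eventually_ge_atTop 1] with N hN hN1
    have hN0 : (0 : ℝ) ≤ N := Nat.cast_nonneg N
    rw [Real.norm_of_nonneg (by positivity), Real.norm_of_nonneg (Real.rpow_nonneg hN0 _)] at hN
    have e2 : Real.log (N : ℝ) ^ (2 : ℝ) = Real.log N ^ 2 := by
      rw [show (2 : ℝ) = ((2 : ℕ) : ℝ) by norm_num, Real.rpow_natCast]
    rwa [e2] at hN
  filter_upwards [eventually_ge_atTop 1024, hE1, hC₁, hE2, hE3, hE4] with N h1024 hPNT hBVN h2 h3 h4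
  -- basic facts about `N` (the `x` of the statement)
  have hN0 : N ≠ 0 := by omega
  have hN1 : (1 : ℝ) < N := by exact_mod_cast (show 1 < N by omega)
  have hNpos : (0 : ℝ) < N := by linarith
  set L := Real.log N with hL
  have hL0 : 0 < L := Real.log_pos hN1
  -- the sieve parameters `z = N^{1/10}`, `D = N^{1/2 - δ}`, `s = log D/log z = 5 - 10δ`
  set zN := (N : ℝ) ^ (1 / 10 : ℝ) with hzN
  set D := (N : ℝ) ^ θ₁ with hD
  have hcz : chenZ N = ⌈zN⌉₊ := rfl
  have hz2 : 2 ≤ zN := by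
    rw [hzN, show (2 : ℝ) = ((2 : ℝ) ^ (10 : ℕ)) ^ (1 / 10 : ℝ) by
      rw [← Real.rpow_natCast, ← Real.rpow_mul (by norm_num)]; norm_num]
    exact Real.rpow_le_rpow (by norm_num) (by norm_num; exact_mod_cast h1024) (by norm_num)
  have hlogz : Real.log zN = 1 / 10 * L := by rw [hzN, Real.log_rpow hNpos]
  have hlogD : Real.log D = θ₁ * L := by rw [hD, Real.log_rpow hNpos]
  have hzD : zN ≤ D := by
    rw [hzN, hD]
    exact Real.rpow_le_rpow_of_exponent_le hN1.le (by rw [hθ₁]; linarith)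
  have hD0 : 0 ≤ D := Real.rpow_nonneg hNpos.le _
  have hs : Real.log D / Real.log zN = 5 - 10 * δ := by
    rw [hlogz, hlogD, hθ₁]; field_simp; ring
  -- the sieve theorem for `chenShiftSeq h N` at height `N + h`, `y = D`, `z = N^{1/10}`
  have hdim := hasIwaniecDimension_chenShiftSeq hh N
  have hmain := hC (chenShiftSeq h N) hdim ((N + h : ℕ) : ℝ) D zN hz2 hzD
    (show (0 : ℝ) ≤ (Nat.primeCounting N : ℝ) from Nat.cast_nonneg _)
  have hsize : (chenShiftSeq h N).size ((N + h : ℕ) : ℝ) = (Nat.primeCounting N : ℝ) := rfl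
  have hfval : B.2.1 (5 - 10 * δ) = lowerSieveFun 1 (5 - 10 * δ) := by
    rw [hfeq (show (0 : ℝ) < 5 - 10 * δ by linarith), ← lowerSieveFun_one]
  rw [sifted_chenShiftSeq, densityProduct_chenShiftSeq, hs, hsize, hfval] at hmain
  -- names
  set V := sieveProduct h zN with hV
  set X := (Nat.primeCounting N : ℝ) with hX
  set R := ∑ d ∈ (range ⌈D⌉₊).filter (· ∣ primesProdBelow zN),
    |(chenShiftSeq h N).remainder d ((N + h : ℕ) : ℝ)| with hR
  set S := (roughCount (shiftSieveSet' h N) ⌈zN⌉₊ : ℝ) with hS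
  set M := (N : ℝ) * V / L with hM
  set c' := lowerSieveFun 1 (5 - 10 * δ) - C * Real.log D ^ (-(1 / 3 : ℝ)) with hc'
  have hVI : 0 ≤ V ∧ V ≤ 1 := sieveProduct_mem_Icc hh zN
  -- (0) `V ≥ 1/(κ₀ L)`, hence `M ≥ N/(κ₀ L²) > 0`
  have hVpos : 0 < V := by
    rw [hV, ← densityProduct_chenShiftSeq h N]; exact hdim.densityProduct_pos zN
  have hVinv : V⁻¹ ≤ κ₀ * L := by
    have h1 := hdim.inv_densityProduct_le hz2
    rw [densityProduct_chenShiftSeq, Real.rpow_one, hlogz] at h1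
    refine h1.trans (le_of_eq ?_)
    rw [hκ₀]; field_simp
  have hMpos : 0 < M := by positivity
  have hKM : (N : ℝ) / (κ₀ * L ^ 2) ≤ M := by
    have h1 : (κ₀ * L)⁻¹ ≤ V := by rw [inv_le_comm₀ (by positivity) hVpos]; exact hVinv
    calc (N : ℝ) / (κ₀ * L ^ 2) = (N : ℝ) / L * (κ₀ * L)⁻¹ := by field_simp
      _ ≤ (N : ℝ) / L * V := mul_le_mul_of_nonneg_left h1 (by positivity)
      _ = M := by rw [hM]; ring
  -- (1) the coefficient: `|c' - a| ≤ 5ε'/16`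
  have herr1 : |C| * Real.log D ^ (-(1 / 3 : ℝ)) ≤ ε' / 16 := by rw [hlogD]; exact h2
  have hCabs : |C * Real.log D ^ (-(1 / 3 : ℝ))| ≤ ε' / 16 := by
    rw [abs_mul, abs_of_nonneg (Real.rpow_nonneg (by rw [hlogD]; positivity) _)]
    exact herr1
  have hclow : a - 5 * ε' / 16 ≤ c' := by
    rw [hc']
    have := (abs_lt.mp hfs).1
    have := (abs_le.mp hCabs).2
    linarith
  have hcabs : |c'| ≤ |a| + 1 := by
    rw [hc']
    calc |lowerSieveFun 1 (5 - 10 * δ) - C * Real.log D ^ (-(1 / 3 : ℝ))|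
        = |a + (lowerSieveFun 1 (5 - 10 * δ) - a) - C * Real.log D ^ (-(1 / 3 : ℝ))| := by ring_nf
      _ ≤ |a + (lowerSieveFun 1 (5 - 10 * δ) - a)| + |C * Real.log D ^ (-(1 / 3 : ℝ))| :=
          abs_sub _ _
      _ ≤ |a| + |lowerSieveFun 1 (5 - 10 * δ) - a| + |C * Real.log D ^ (-(1 / 3 : ℝ))| := by
          gcongr; exact abs_add_le _ _
      _ ≤ |a| + ε' / 4 + ε' / 16 := by gcongr
      _ ≤ |a| + 1 := by linarith
  -- (2) the main term: `X V c' ≥ (a - 6ε'/16) M`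
  have hXlow : (1 - η) * ((N : ℝ) / L) ≤ X := hPNT.1
  have hXup : X ≤ (1 + η) * ((N : ℝ) / L) := hPNT.2
  have hXdiff : |X - (N : ℝ) / L| ≤ η * ((N : ℝ) / L) := by
    rw [abs_le]; constructor <;> nlinarith
  have hmainTerm : (a - 6 * ε' / 16) * M ≤ X * V * c' := by
    have hηa : η * (|a| + 1) = ε' / 16 := by rw [hη]; field_simp
    have hNL : 0 ≤ (N : ℝ) / L * V := by positivity
    have h1 : (N : ℝ) / L * V * (a - 5 * ε' / 16) ≤ (N : ℝ) / L * V * c' :=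
      mul_le_mul_of_nonneg_left hclow hNL
    have h2' : |(X - (N : ℝ) / L) * V * c'| ≤ η * ((N : ℝ) / L) * V * (|a| + 1) := by
      rw [abs_mul, abs_mul, abs_of_nonneg hVI.1]
      have := mul_le_mul (mul_le_mul_of_nonneg_right hXdiff hVI.1) hcabs (abs_nonneg _)
        (by positivity)
      linarith
    have h3' := neg_abs_le ((X - (N : ℝ) / L) * V * c')
    calc (a - 6 * ε' / 16) * M
        = (N : ℝ) / L * V * (a - 5 * ε' / 16) - η * ((N : ℝ) / L) * V * (|a| + 1) := by
          rw [hM, show η * ((N : ℝ) / L) * V * (|a| + 1) = η * (|a| + 1) * ((N : ℝ) / L * V) by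
            ring, hηa]; ring
      _ ≤ (N : ℝ) / L * V * c' + (X - (N : ℝ) / L) * V * c' := by linarith
      _ = X * V * c' := by ring
  -- (3) the remainder: `R ≤ C₁ N/L⁴ + D (h + 1) ≤ (ε'/8) M`
  have hRle : R ≤ C₁ * N / L ^ 4 + D * ((h : ℝ) + 1) := by
    refine (remainderSum_chenShiftSeq_le hh0 N zN hD0).trans ?_
    have hb := hBVN (negResUnit h)
    rw [show (4 : ℝ) = ((4 : ℕ) : ℝ) by norm_num, Real.rpow_natCast] at hb
    exact add_le_add hb le_rfl
  have hR1 : C₁ * N / L ^ 4 ≤ ε' / 16 * M := by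
    have h3' : 16 * κ₀ * max C₁ 0 ≤ ε' * L ^ 2 := h3
    calc C₁ * N / L ^ 4 ≤ max C₁ 0 * N / L ^ 4 := by
          rw [mul_div_assoc, mul_div_assoc]
          exact mul_le_mul_of_nonneg_right (le_max_left _ _) (by positivity)
      _ = (16 * κ₀ * max C₁ 0) * (N / (16 * κ₀ * L ^ 4)) := by field_simp
      _ ≤ (ε' * L ^ 2) * (N / (16 * κ₀ * L ^ 4)) := mul_le_mul_of_nonneg_right h3' (by positivity)
      _ = ε' / 16 * (N / (κ₀ * L ^ 2)) := by field_simp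
      _ ≤ ε' / 16 * M := mul_le_mul_of_nonneg_left hKM (by positivity)
  have hR2 : D * ((h : ℝ) + 1) ≤ ε' / 16 * M := by
    have hsplit : (N : ℝ) = D * (N : ℝ) ^ (1 - θ₁) := by
      rw [hD, ← Real.rpow_add hNpos, show θ₁ + (1 - θ₁) = 1 by ring, Real.rpow_one]
    calc D * ((h : ℝ) + 1) = D * ((h : ℝ) + 1) * L ^ 2 / L ^ 2 := by field_simp
      _ ≤ D * ((h : ℝ) + 1) * (ε' / (16 * κ₀ * ((h : ℝ) + 1)) * (N : ℝ) ^ (1 - θ₁)) / L ^ 2 := by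
          gcongr
      _ = ε' / 16 * ((D * (N : ℝ) ^ (1 - θ₁)) / (κ₀ * L ^ 2)) := by field_simp
      _ = ε' / 16 * (N / (κ₀ * L ^ 2)) := by rw [← hsplit]
      _ ≤ ε' / 16 * M := mul_le_mul_of_nonneg_left hKM (by positivity)
  -- (4) combine: `S ≥ (a - 8ε'/16) M ≥ (a - ε) M`, and `S ≤ roughCount (shiftSieveSet h N) (chenZ N)`
  have hSge : (a - 8 * ε' / 16) * M ≤ S := by
    have e : (a - 8 * ε' / 16) * M = (a - 6 * ε' / 16) * M - (ε' / 16 * M + ε' / 16 * M) := by ring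
    have hm : X * V * c' - R ≤ S := hmain
    linarith [hmainTerm, hRle, hR1, hR2]
  have hmono : S ≤ (roughCount (shiftSieveSet h N) (chenZ N) : ℝ) := by
    rw [hS, hcz]
    exact_mod_cast roughCount_shiftSieveSet'_le h N ⌈zN⌉₊
  show (a - ε) * M ≤ (roughCount (shiftSieveSet h N) (chenZ N) : ℝ)
  have h5 : (a - ε) * M ≤ (a - 8 * ε' / 16) * M := mul_le_mul_of_nonneg_right (by linarith) hMpos.le
  linarith

end Literature.NumberTheory.Sieve.Chen
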